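import Literature.NumberTheory.Sieve.CFSemigroupTwistedOpGap
import Literature.NumberTheory.Sieve.CFSemigroupLaplace
import HarnessLib

/-!
# The resolvent of the congruence transfer operator: constants ⊕ mean-zero families

Support file (all results proved) for the named fact
`Literature.NumberTheory.Sieve.MageeOhWinter2019_uniformCounting` (`CFSemigroupCounting.lean`).
For the congruence transfer operator `𝓜_s = cfTwist A hA q s` of [MageeOhWinter2019, §3.2] on
`V = SL₂(ℤ/qℤ) → CfLip` the decomposition `V = V₀ ⊕ V₁` into `ξ`-constant families and families with
`Σ_ξ F_ξ = 0` is `𝓜_s`-invariant for every `s` (`cfTwist_const`, `sum_cfTwist_apply`); on `V₀ ≅ CfLip`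
the operator is `L_s²`. Hence ([MageeOhWinter2019, §3.2, "the main term comes from the trivial
representation"]) the resolvent splits as

  `(1 - 𝓜_s)⁻¹ = E (1 - L_s²)⁻¹ Av + (1 - B_s)⁻¹ P₁`,  `B_s = 𝓜_s P₁`,

where `E` embeds constants, `Av` averages the fibres, `P₀ = E Av`, `P₁ = 1 - P₀`
(`cfTwist_inverse_eq`). The first summand carries the pole at `s = δ` (scalar theory,
`CFSemigroupLaplace.lean`), the second is holomorphic near `s = δ` for fixed `q`: `‖B_δⁿ‖ ≤ C rⁿ` by
the operator gap `cfTwist_opGap`, so `1 - B_δ` is a unit (`isUnit_one_sub_cfTwB_delta`) and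
`s ↦ (1 - B_s)⁻¹` is continuous near `δ` (`continuousAt_inverse_one_sub_cfTwB`). Also:
holomorphy of `s ↦ 𝓜_s` (`analyticAt_cfTwist`). [cite: MageeOhWinter2019, §3.2]

## References

* M. Magee, H. Oh, D. Winter, J. reine angew. Math. 753 (2019) 89–135, §3.2. [MageeOhWinter2019]
-/

noncomputable section

open Set Filter Topology
open scoped MatrixGroups

namespace Literature.NumberTheory.Sieve

variable {A : Finset ℕ}

section Resolvent

variable (A) (hA : ∀ a ∈ A, 1 ≤ a) (h2 : 2 ≤ A.card) (q : ℕ) [NeZero q]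
include hA

/-! ### Holomorphy of `s ↦ 𝓜_s` -/

omit hA in
/-- The embedding of the `ξ`-th fibre: `G ↦ (η ↦ δ_{ηξ} G)`. [folklore] -/
def cfTwSingle (ξ : SL(2, ZMod q)) : CfLip →L[ℂ] (SL(2, ZMod q) → CfLip) :=
  ContinuousLinearMap.pi (Pi.single ξ (ContinuousLinearMap.id ℂ CfLip))

omit hA [NeZero q] in
/-- Components of the fibre embedding. [folklore] -/
@[simp] theorem cfTwSingle_apply (ξ η : SL(2, ZMod q)) (G : CfLip) :
    cfTwSingle q ξ G η = if η = ξ then G else 0 := by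
  simp only [cfTwSingle, ContinuousLinearMap.pi_apply]
  by_cases h : η = ξ
  · subst h; simp
  · simp [h]

/-- **`𝓜_s` as a finite sum of compositions with fixed maps:**
`𝓜_s = Σ_ξ Σ_{a,b} ι_ξ ∘ L_{s,(a,b)} ∘ proj_{ξσ_{ab}}`. [cite: MageeOhWinter2019, §3.2] -/
theorem cfTwist_eq_sum_single (s : ℂ) :
    cfTwist A hA q s = ∑ ξ : SL(2, ZMod q), ∑ a ∈ A.attach, ∑ b ∈ A.attach,
      (cfTwSingle q ξ).comp ((cfPairOp (hA a a.2) (hA b b.2) s).comp (ContinuousLinearMap.proj (ξ * cfSigma q a b))) := by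
  refine ContinuousLinearMap.ext fun F => funext fun η => ?_
  rw [cfTwist_apply]
  simp only [_root_.sum_apply, Finset.sum_apply, ContinuousLinearMap.coe_comp,
    Function.comp_apply, ContinuousLinearMap.proj_apply, cfTwSingle_apply]
  rw [Finset.sum_eq_single η (fun ξ _ hne => by simp [Ne.symm hne]) (fun h => absurd (Finset.mem_univ η) h)]
  simp

omit hA [NeZero q] in
/-- **`s ↦ L_{s,(a,b)}` is analytic.** [cite: MageeOhWinter2019, §3.4] -/
theorem analyticAt_cfPairOp {a b : ℕ} (ha : 1 ≤ a) (hb : 1 ≤ b) (s : ℂ) :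
    AnalyticAt ℂ (fun s => cfPairOp ha hb s) s := by
  unfold cfPairOp cfLOp1
  exact (analyticAt_cfLOp {b} _ s).mul (analyticAt_cfLOp {a} _ s)

/-- **`s ↦ 𝓜_s` is analytic** (entire, with values in the operators on `SL₂(ℤ/qℤ) → CfLip`).
[cite: MageeOhWinter2019, §3.4] -/
theorem analyticAt_cfTwist (s : ℂ) : AnalyticAt ℂ (fun s => cfTwist A hA q s) s := by
  have h : (fun s => cfTwist A hA q s) = fun s => ∑ ξ : SL(2, ZMod q), ∑ a ∈ A.attach, ∑ b ∈ A.attach,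
      (cfTwSingle q ξ).comp ((cfPairOp (hA a a.2) (hA b b.2) s).comp (ContinuousLinearMap.proj (ξ * cfSigma q a b))) :=
    funext fun s => cfTwist_eq_sum_single A hA q s
  rw [h]
  refine Finset.analyticAt_fun_sum _ fun ξ _ => Finset.analyticAt_fun_sum _ fun a _ => Finset.analyticAt_fun_sum _ fun b _ => ?_
  -- `T ↦ ι ∘ T ∘ proj` is a continuous linear map of `T`
  set Φ : (CfLip →L[ℂ] CfLip) →L[ℂ] ((SL(2, ZMod q) → CfLip) →L[ℂ] (SL(2, ZMod q) → CfLip)) :=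
    (ContinuousLinearMap.compL ℂ (SL(2, ZMod q) → CfLip) CfLip (SL(2, ZMod q) → CfLip) (cfTwSingle q ξ)).comp
      ((ContinuousLinearMap.compL ℂ (SL(2, ZMod q) → CfLip) CfLip CfLip).flip
        (ContinuousLinearMap.proj (R := ℂ) (φ := fun _ : SL(2, ZMod q) => CfLip) (ξ * cfSigma q a b))) with hΦ
  have hΦapp : ∀ T : CfLip →L[ℂ] CfLip, Φ T =
      (cfTwSingle q ξ).comp (T.comp (ContinuousLinearMap.proj (ξ * cfSigma q a b))) := fun T => rfl
  have h2' : (fun s => (cfTwSingle q ξ).comp ((cfPairOp (hA a a.2) (hA b b.2) s).comp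
      (ContinuousLinearMap.proj (ξ * cfSigma q a b)))) = fun s => Φ (cfPairOp (hA a a.2) (hA b b.2) s) :=
    funext fun s => (hΦapp _).symm
  rw [h2']
  exact (Φ.analyticAt _).comp (analyticAt_cfPairOp (hA a a.2) (hA b b.2) s)

/-- `s ↦ 𝓜_s` is continuous. [cite: MageeOhWinter2019, §3.4] -/
theorem continuous_cfTwist : Continuous fun s => cfTwist A hA q s :=
  continuous_iff_continuousAt.2 fun s => (analyticAt_cfTwist A hA q s).continuousAt

/-! ### Constants, averages and the projections `P₀`, `P₁` -/

omit hA in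
/-- The embedding of constants `E G = (ξ ↦ G)`. [folklore] -/
def cfTwE : CfLip →L[ℂ] (SL(2, ZMod q) → CfLip) := ContinuousLinearMap.pi fun _ => ContinuousLinearMap.id ℂ CfLip

omit hA in
/-- The fibre average `Av F = |Γ_q|⁻¹ Σ_ξ F_ξ`. [folklore] -/
def cfTwAv : (SL(2, ZMod q) → CfLip) →L[ℂ] CfLip :=
  ((Fintype.card (SL(2, ZMod q)) : ℂ)⁻¹) • ∑ ξ, ContinuousLinearMap.proj ξ

omit hA [NeZero q] in
/-- Components of the constant embedding. [folklore] -/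
@[simp] theorem cfTwE_apply (G : CfLip) (ξ : SL(2, ZMod q)) : cfTwE q G ξ = G := rfl

omit hA in
/-- Formula for the fibre average. [folklore] -/
theorem cfTwAv_apply (F : SL(2, ZMod q) → CfLip) :
    cfTwAv q F = ((Fintype.card (SL(2, ZMod q)) : ℂ)⁻¹) • ∑ ξ, F ξ := by
  simp [cfTwAv]

omit hA in
/-- `Av ∘ E = 1`. [folklore] -/
theorem cfTwAv_cfTwE (G : CfLip) : cfTwAv q (cfTwE q G) = G := by
  rw [cfTwAv_apply]
  simp only [cfTwE_apply, Finset.sum_const, Finset.card_univ]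
  rw [← Nat.cast_smul_eq_nsmul ℂ, smul_smul, inv_mul_cancel₀ (by exact_mod_cast Fintype.card_ne_zero), one_smul]

omit hA in
/-- The projection onto constant families `P₀ = E ∘ Av`. [folklore] -/
def cfTwP0 : (SL(2, ZMod q) → CfLip) →L[ℂ] (SL(2, ZMod q) → CfLip) := (cfTwE q).comp (cfTwAv q)

omit hA in
/-- The complementary projection `P₁ = 1 - P₀` (onto mean-zero families). [folklore] -/
def cfTwP1 : (SL(2, ZMod q) → CfLip) →L[ℂ] (SL(2, ZMod q) → CfLip) := 1 - cfTwP0 q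

omit hA in
/-- Components of `P₀ F` are the average. [folklore] -/
theorem cfTwP0_apply (F : SL(2, ZMod q) → CfLip) (ξ : SL(2, ZMod q)) : cfTwP0 q F ξ = cfTwAv q F := rfl

omit hA in
/-- `P₀² = P₀`. [folklore] -/
theorem cfTwP0_idem : cfTwP0 q * cfTwP0 q = cfTwP0 q := by
  refine ContinuousLinearMap.ext fun F => funext fun ξ => ?_
  rw [ContinuousLinearMap.mul_def, ContinuousLinearMap.coe_comp, Function.comp_apply, cfTwP0_apply, cfTwP0_apply]
  show cfTwAv q (cfTwE q (cfTwAv q F)) = cfTwAv q F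
  rw [cfTwAv_cfTwE]

omit hA in
/-- `P₁ P₀ = 0`, `P₀ P₁ = 0`, `P₁² = P₁`. [folklore] -/
theorem cfTwP1_mul : cfTwP1 q * cfTwP0 q = 0 ∧ cfTwP0 q * cfTwP1 q = 0 ∧ cfTwP1 q * cfTwP1 q = cfTwP1 q := by
  have h := cfTwP0_idem q
  refine ⟨?_, ?_, ?_⟩
  · rw [cfTwP1, sub_mul, one_mul, h, sub_self]
  · rw [cfTwP1, mul_sub, mul_one, h, sub_self]
  · rw [cfTwP1, sub_mul, one_mul, mul_sub, mul_one, h, sub_self, sub_zero]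

omit [NeZero q] in
/-- **`𝓜_s E = E L_s²`** (constants go to constants). [cite: MageeOhWinter2019, §3.2] -/
theorem cfTwist_mul_cfTwE (s : ℂ) : (cfTwist A hA q s).comp (cfTwE q) = (cfTwE q).comp (cfLOp A hA s ^ 2) := by
  refine ContinuousLinearMap.ext fun G => funext fun ξ => ?_
  rw [ContinuousLinearMap.coe_comp, Function.comp_apply, ContinuousLinearMap.coe_comp, Function.comp_apply, cfTwE_apply]
  exact cfTwist_const A hA q s G ξ

/-- **`Av 𝓜_s = L_s² Av`** (the fibre sum is transported by `L_s²`). [cite: MageeOhWinter2019, §3.2] -/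
theorem cfTwAv_mul_cfTwist (s : ℂ) : (cfTwAv q).comp (cfTwist A hA q s) = (cfLOp A hA s ^ 2).comp (cfTwAv q) := by
  refine ContinuousLinearMap.ext fun F => ?_
  rw [ContinuousLinearMap.coe_comp, Function.comp_apply, ContinuousLinearMap.coe_comp, Function.comp_apply,
    cfTwAv_apply, cfTwAv_apply, sum_cfTwist_apply, map_smul]

/-- `P₀` commutes with `𝓜_s`. [cite: MageeOhWinter2019, §3.2] -/
theorem cfTwP0_comm (s : ℂ) : cfTwP0 q * cfTwist A hA q s = cfTwist A hA q s * cfTwP0 q := by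
  rw [cfTwP0, ContinuousLinearMap.mul_def, ContinuousLinearMap.mul_def, ContinuousLinearMap.comp_assoc,
    cfTwAv_mul_cfTwist A hA q s, ← ContinuousLinearMap.comp_assoc, ← cfTwist_mul_cfTwE A hA q s,
    ContinuousLinearMap.comp_assoc]

/-- `P₁` commutes with `𝓜_s`. [cite: MageeOhWinter2019, §3.2] -/
theorem cfTwP1_comm (s : ℂ) : cfTwP1 q * cfTwist A hA q s = cfTwist A hA q s * cfTwP1 q := by
  rw [cfTwP1, sub_mul, mul_sub, one_mul, mul_one, cfTwP0_comm A hA q s]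

include h2 in
/-- `Π_q = E ∘ Π ∘ Av` and hence `Π_q P₁ = 0`. [cite: MageeOhWinter2019, §3.2] -/
theorem cfTwPi_mul_cfTwP1 : cfTwPi A hA h2 * cfTwP1 q = (0 : (SL(2, ZMod q) → CfLip) →L[ℂ] _) := by
  have hPi : cfTwPi A hA h2 (q := q) = (cfTwE q).comp ((cfPi A hA h2).comp (cfTwAv q)) := by
    refine ContinuousLinearMap.ext fun F => funext fun ξ => ?_
    rw [cfTwPi_apply, ContinuousLinearMap.coe_comp, Function.comp_apply, ContinuousLinearMap.coe_comp,
      Function.comp_apply, cfTwE_apply, cfPi_apply, cfTwAv_apply, map_smul, map_sum, smul_eq_mul]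
  have hPiP0 : cfTwPi A hA h2 * cfTwP0 q = cfTwPi A hA h2 (q := q) := by
    rw [hPi, cfTwP0, ContinuousLinearMap.mul_def, ContinuousLinearMap.comp_assoc, ContinuousLinearMap.comp_assoc,
      ← ContinuousLinearMap.comp_assoc (cfTwAv q) (cfTwE q) (cfTwAv q)]
    congr 2
    refine ContinuousLinearMap.ext fun F => ?_
    rw [ContinuousLinearMap.coe_comp, Function.comp_apply, ContinuousLinearMap.coe_comp, Function.comp_apply, cfTwAv_cfTwE]
  rw [cfTwP1, mul_sub, mul_one, hPiP0, sub_self]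

/-! ### `B_s = 𝓜_s P₁` and its Neumann inverse at `s = δ` -/

/-- **The mean-zero part of the congruence operator:** `B_s = 𝓜_s P₁`. [cite: MageeOhWinter2019, §3.2] -/
def cfTwB (s : ℂ) : (SL(2, ZMod q) → CfLip) →L[ℂ] (SL(2, ZMod q) → CfLip) := cfTwist A hA q s * cfTwP1 q

/-- `B_s = P₁ 𝓜_s` as well; `B_s P₁ = B_s = P₁ B_s`. [folklore] -/
theorem cfTwB_props (s : ℂ) :
    cfTwB A hA q s = cfTwP1 q * cfTwist A hA q s ∧ cfTwB A hA q s * cfTwP1 q = cfTwB A hA q s ∧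
      cfTwP1 q * cfTwB A hA q s = cfTwB A hA q s := by
  obtain ⟨-, -, h11⟩ := cfTwP1_mul q
  refine ⟨by rw [cfTwB, cfTwP1_comm A hA q s], by rw [cfTwB, mul_assoc, h11], ?_⟩
  rw [cfTwB, ← mul_assoc, cfTwP1_comm A hA q s, mul_assoc, h11]

/-- Powers: `B_sⁿ = 𝓜_sⁿ P₁` for `n ≥ 1`. [folklore] -/
theorem cfTwB_pow (s : ℂ) : ∀ n : ℕ, 1 ≤ n → cfTwB A hA q s ^ n = cfTwist A hA q s ^ n * cfTwP1 q
  | 0, h => absurd h (by norm_num)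
  | 1, _ => by rw [pow_one, pow_one, cfTwB]
  | n + 2, _ => by
      have ih := cfTwB_pow s (n + 1) (by omega)
      obtain ⟨-, -, h11⟩ := cfTwP1_mul q
      rw [pow_succ, ih, cfTwB, mul_assoc, ← mul_assoc (cfTwP1 q), cfTwP1_comm A hA q s, mul_assoc, h11,
        ← mul_assoc, ← pow_succ]

/-- `s ↦ B_s` is analytic. [folklore] -/
theorem analyticAt_cfTwB (s : ℂ) : AnalyticAt ℂ (fun s => cfTwB A hA q s) s :=
  (analyticAt_cfTwist A hA q s).mul analyticAt_const

/-- `s ↦ B_s` is continuous. [folklore] -/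
theorem continuous_cfTwB : Continuous fun s => cfTwB A hA q s :=
  (continuous_cfTwist A hA q).mul continuous_const

include h2 in
/-- **Geometric decay of `B_δⁿ`:** `‖B_δⁿ‖ ≤ C ‖P₁‖ rⁿ` under primitivity (`Π_q P₁ = 0`). [cite: MageeOhWinter2019, §3.2] -/
theorem norm_cfTwB_delta_pow_le {n₀ : ℕ}
    (hprim : ∀ n ≥ n₀, ∀ ξ η : SL(2, ZMod q), ∃ w : List (A × A), w.length = n ∧ ξ * cfSigmaWord A q w = η) :
    ∃ C r : ℝ, 0 ≤ C ∧ 0 < r ∧ r < 1 ∧ ∀ n : ℕ, 1 ≤ n → ‖cfTwB A hA q (cfDimension A : ℂ) ^ n‖ ≤ C * r ^ n := by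
  obtain ⟨C, r, hC, hr0, hr1, hgap⟩ := cfTwist_opGap A hA h2 hprim
  refine ⟨C * ‖cfTwP1 q‖, r, by positivity, hr0, hr1, fun n hn => ?_⟩
  rw [cfTwB_pow A hA q _ n hn]
  have h : cfTwist A hA q (cfDimension A : ℂ) ^ n * cfTwP1 q = (cfTwist A hA q (cfDimension A : ℂ) ^ n - cfTwPi A hA h2) * cfTwP1 q := by
    rw [sub_mul, cfTwPi_mul_cfTwP1 A hA h2 q, sub_zero]
  rw [h]
  calc ‖(cfTwist A hA q (cfDimension A : ℂ) ^ n - cfTwPi A hA h2) * cfTwP1 q‖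
      ≤ ‖cfTwist A hA q (cfDimension A : ℂ) ^ n - cfTwPi A hA h2‖ * ‖cfTwP1 q‖ := norm_mul_le _ _
    _ ≤ C * r ^ n * ‖cfTwP1 q‖ := mul_le_mul_of_nonneg_right (hgap n) (norm_nonneg _)
    _ = C * ‖cfTwP1 q‖ * r ^ n := by ring

include h2 in
/-- **Summable norms of `B_δⁿ`**, hence `1 - B_δ` is a unit. [cite: MageeOhWinter2019, §3.2] -/
theorem isUnit_one_sub_cfTwB_delta {n₀ : ℕ}
    (hprim : ∀ n ≥ n₀, ∀ ξ η : SL(2, ZMod q), ∃ w : List (A × A), w.length = n ∧ ξ * cfSigmaWord A q w = η) :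
    (Summable fun n => ‖cfTwB A hA q (cfDimension A : ℂ) ^ n‖) ∧ IsUnit (1 - cfTwB A hA q (cfDimension A : ℂ)) := by
  obtain ⟨C, r, hC, hr0, hr1, hB⟩ := norm_cfTwB_delta_pow_le A hA h2 q hprim
  have hs : Summable fun n => ‖cfTwB A hA q (cfDimension A : ℂ) ^ n‖ := by
    refine Summable.of_norm_bounded_eventually_nat (g := fun n => C * r ^ n)
      ((summable_geometric_of_lt_one hr0.le hr1).mul_left C) ?_
    filter_upwards [Filter.eventually_ge_atTop 1] with n hn
    rw [Real.norm_eq_abs, abs_of_nonneg (norm_nonneg _)]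
    exact hB n hn
  exact ⟨hs, isUnit_one_sub_of_summable_norm_pow hs⟩

include h2 in
/-- **`1 - B_s` stays a unit near `s = δ`**, and `s ↦ (1 - B_s)⁻¹` is continuous there. [cite: MageeOhWinter2019, §3.2] -/
theorem eventually_isUnit_one_sub_cfTwB {n₀ : ℕ}
    (hprim : ∀ n ≥ n₀, ∀ ξ η : SL(2, ZMod q), ∃ w : List (A × A), w.length = n ∧ ξ * cfSigmaWord A q w = η) :
    ∀ᶠ s in 𝓝 (cfDimension A : ℂ), IsUnit (1 - cfTwB A hA q s) :=
  (continuous_const.sub (continuous_cfTwB A hA q)).continuousAt.preimage_mem_nhds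
    (Units.isOpen.mem_nhds (isUnit_one_sub_cfTwB_delta A hA h2 q hprim).2)

/-- Continuity of `s ↦ (1 - B_s)⁻¹` at every `s` where `1 - B_s` is a unit. [folklore] -/
theorem continuousAt_inverse_one_sub_cfTwB {s : ℂ} (hs : IsUnit (1 - cfTwB A hA q s)) :
    ContinuousAt (fun s => Ring.inverse (1 - cfTwB A hA q s)) s := by
  obtain ⟨u, hu⟩ := hs
  have h1 : ContinuousAt Ring.inverse ((1 : (SL(2, ZMod q) → CfLip) →L[ℂ] _) - cfTwB A hA q s) := by
    rw [← hu]; exact NormedRing.inverse_continuousAt u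
  exact ContinuousAt.comp (g := Ring.inverse) h1 (continuous_const.sub (continuous_cfTwB A hA q)).continuousAt

/-! ### The resolvent decomposition -/

omit hA in
/-- Lifting a scalar operator to constant families: `lift X = E ∘ X ∘ Av`. [folklore] -/
def cfTwLift (X : CfLip →L[ℂ] CfLip) : (SL(2, ZMod q) → CfLip) →L[ℂ] (SL(2, ZMod q) → CfLip) :=
  (cfTwE q).comp (X.comp (cfTwAv q))

omit hA in
/-- Components of `lift X F`. [folklore] -/
theorem cfTwLift_apply (X : CfLip →L[ℂ] CfLip) (F : SL(2, ZMod q) → CfLip) (ξ : SL(2, ZMod q)) :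
    cfTwLift q X F ξ = X (cfTwAv q F) := rfl

omit hA in
/-- `lift X · lift Y = lift (X Y)` (`Av E = 1`). [folklore] -/
theorem cfTwLift_mul (X Y : CfLip →L[ℂ] CfLip) : cfTwLift q X * cfTwLift q Y = cfTwLift q (X * Y) := by
  refine ContinuousLinearMap.ext fun F => funext fun ξ => ?_
  rw [ContinuousLinearMap.mul_def, ContinuousLinearMap.coe_comp, Function.comp_apply, cfTwLift_apply, cfTwLift_apply,
    ContinuousLinearMap.mul_def, ContinuousLinearMap.coe_comp, Function.comp_apply]
  congr 1
  exact cfTwAv_cfTwE q _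

omit hA in
/-- `lift 1 = P₀`. [folklore] -/
theorem cfTwLift_one : cfTwLift q 1 = cfTwP0 q := rfl

omit hA in
/-- `P₁ · lift X = 0 = lift X · P₁`. [folklore] -/
theorem cfTwP1_mul_cfTwLift (X : CfLip →L[ℂ] CfLip) : cfTwP1 q * cfTwLift q X = 0 ∧ cfTwLift q X * cfTwP1 q = 0 := by
  have h1 : cfTwP0 q * cfTwLift q X = cfTwLift q X := by
    rw [← cfTwLift_one, cfTwLift_mul, one_mul]
  have h2 : cfTwLift q X * cfTwP0 q = cfTwLift q X := by
    rw [← cfTwLift_one, cfTwLift_mul, mul_one]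
  constructor
  · rw [cfTwP1, sub_mul, one_mul, h1, sub_self]
  · rw [cfTwP1, mul_sub, mul_one, h2, sub_self]

/-- `𝓜_s · lift X = lift (L_s² X)` and `lift X · 𝓜_s = lift (X L_s²)`. [cite: MageeOhWinter2019, §3.2] -/
theorem cfTwist_mul_cfTwLift (s : ℂ) (X : CfLip →L[ℂ] CfLip) :
    cfTwist A hA q s * cfTwLift q X = cfTwLift q (cfLOp A hA s ^ 2 * X) ∧
      cfTwLift q X * cfTwist A hA q s = cfTwLift q (X * cfLOp A hA s ^ 2) := by
  constructor
  · rw [ContinuousLinearMap.mul_def, cfTwLift, cfTwLift, ← ContinuousLinearMap.comp_assoc, cfTwist_mul_cfTwE A hA q s,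
      ContinuousLinearMap.mul_def]
    simp only [ContinuousLinearMap.comp_assoc]
  · simp only [ContinuousLinearMap.mul_def, cfTwLift, ContinuousLinearMap.comp_assoc, cfTwAv_mul_cfTwist A hA q s]

omit hA in
/-- `lift` is additive: `lift (X - Y) = lift X - lift Y`. [folklore] -/
theorem cfTwLift_sub (X Y : CfLip →L[ℂ] CfLip) : cfTwLift q (X - Y) = cfTwLift q X - cfTwLift q Y := by
  rfl

/-- **The resolvent of `𝓜_s` from the resolvents of `L_s²` and `B_s`:** if `1 - L_s²` and `1 - B_s`
are units then `1 - 𝓜_s` is a unit with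
`(1 - 𝓜_s)⁻¹ = lift((1 - L_s²)⁻¹) + (1 - B_s)⁻¹ P₁`. [cite: MageeOhWinter2019, §3.2] -/
theorem cfTwist_inverse_eq {s : ℂ} (hL : IsUnit (1 - cfLOp A hA s ^ 2)) (hB : IsUnit (1 - cfTwB A hA q s)) :
    IsUnit (1 - cfTwist A hA q s) ∧
      Ring.inverse (1 - cfTwist A hA q s) =
        cfTwLift q (Ring.inverse (1 - cfLOp A hA s ^ 2)) + Ring.inverse (1 - cfTwB A hA q s) * cfTwP1 q := by
  obtain ⟨u, hu⟩ := hL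
  obtain ⟨v, hv⟩ := hB
  obtain ⟨-, -, h11⟩ := cfTwP1_mul q
  obtain ⟨hBP, hBP1, hP1B⟩ := cfTwB_props A hA q s
  set M := cfTwist A hA q s with hM
  set P1 := cfTwP1 q with hP1
  have hu' : (u : CfLip →L[ℂ] CfLip) = 1 - cfLOp A hA s ^ 2 := hu
  have hv' : (v : (SL(2, ZMod q) → CfLip) →L[ℂ] _) = 1 - cfTwB A hA q s := hv
  set ui : CfLip →L[ℂ] CfLip := ((u⁻¹ : (CfLip →L[ℂ] CfLip)ˣ) : CfLip →L[ℂ] CfLip) with hui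
  set vi : (SL(2, ZMod q) → CfLip) →L[ℂ] (SL(2, ZMod q) → CfLip) :=
    ((v⁻¹ : ((SL(2, ZMod q) → CfLip) →L[ℂ] (SL(2, ZMod q) → CfLip))ˣ) : (SL(2, ZMod q) → CfLip) →L[ℂ] (SL(2, ZMod q) → CfLip))
    with hvi
  have huui : (1 - cfLOp A hA s ^ 2) * ui = 1 := by rw [← hu', hui, Units.mul_inv]
  have huiu : ui * (1 - cfLOp A hA s ^ 2) = 1 := by rw [← hu', hui, Units.inv_mul]
  have hvvi : (v : (SL(2, ZMod q) → CfLip) →L[ℂ] _) * vi = 1 := by rw [hvi, Units.mul_inv]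
  have hviv : vi * (v : (SL(2, ZMod q) → CfLip) →L[ℂ] _) = 1 := by rw [hvi, Units.inv_mul]
  have hvP : Commute P1 (v : (SL(2, ZMod q) → CfLip) →L[ℂ] _) := by
    show P1 * (v : (SL(2, ZMod q) → CfLip) →L[ℂ] _) = (v : (SL(2, ZMod q) → CfLip) →L[ℂ] _) * P1
    rw [hv', mul_sub, sub_mul, mul_one, one_mul, hP1B, hBP1]
  have hvinvP : P1 * vi = vi * P1 := by rw [hvi]; exact (Commute.units_inv_right hvP).eq
  have hP01 : cfTwP0 q + P1 = 1 := by rw [hP1, cfTwP1, add_sub_cancel]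
  -- `(1 - M) P₁ = v P₁` and `P₁ (1 - M) = v P₁`
  have hMP : (1 - M) * P1 = (v : (SL(2, ZMod q) → CfLip) →L[ℂ] _) * P1 := by
    rw [hv', sub_mul, sub_mul, one_mul, hBP1, cfTwB]
  have hPM : P1 * (1 - M) = (v : (SL(2, ZMod q) → CfLip) →L[ℂ] _) * P1 := by
    rw [hv', mul_sub, sub_mul, mul_one, one_mul, ← hBP, hBP1]
  set R : (SL(2, ZMod q) → CfLip) →L[ℂ] (SL(2, ZMod q) → CfLip) := cfTwLift q ui + vi * P1 with hR
  have hleft : (1 - M) * R = 1 := by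
    have e1 : (1 - M) * cfTwLift q ui = cfTwP0 q := by
      rw [sub_mul, one_mul, (cfTwist_mul_cfTwLift A hA q s _).1, ← cfTwLift_one, ← huui, sub_mul, one_mul, cfTwLift_sub]
    have e2 : (1 - M) * (vi * P1) = P1 := by
      rw [← hvinvP, ← mul_assoc, hMP, mul_assoc, hvinvP, ← mul_assoc, hvvi, one_mul]
    rw [hR, mul_add, e1, e2, hP01]
  have hright : R * (1 - M) = 1 := by
    have e1 : cfTwLift q ui * (1 - M) = cfTwP0 q := by
      rw [mul_sub, mul_one, (cfTwist_mul_cfTwLift A hA q s _).2, ← cfTwLift_one, ← huiu, mul_sub, mul_one, cfTwLift_sub]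
    have e2 : vi * P1 * (1 - M) = P1 := by
      rw [mul_assoc, hPM, ← mul_assoc, hviv, one_mul]
    rw [hR, add_mul, e1, e2, hP01]
  set w : ((SL(2, ZMod q) → CfLip) →L[ℂ] (SL(2, ZMod q) → CfLip))ˣ := ⟨1 - M, R, hleft, hright⟩
  refine ⟨⟨w, rfl⟩, ?_⟩
  have hinvM : Ring.inverse (1 - M) = R := Ring.inverse_unit w
  have hinvL : Ring.inverse (1 - cfLOp A hA s ^ 2) = ui := by rw [← hu', Ring.inverse_unit]
  have hinvB : Ring.inverse (1 - cfTwB A hA q s) = vi := by rw [← hv', Ring.inverse_unit]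
  rw [hinvM, hinvL, hinvB]

end Resolvent

end Literature.NumberTheory.Sieve
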